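import Summits.ResolutionOfSingularities.ResolutionOfSingularities.Theorems.WeightedInvariantLocalWeightedDropNCDirectrixCutWeierstrassTransport

/-! # W4.3 `LocalWeightedDrop` — the directrix cut, order-`p` split of the wild core in GOOD position:
THE TWO WEIERSTRASS LEAVES `T` (Cossart–Piltant scope at `p = 2`) and `F` (Weierstrass factors of a reducible prepared equation), sorry-free
[OURS · L1 W4.3 · crux stmt-ResolutionOfSingularities-8899 · author res-L1-w43-strat-1 (gen 11), for verbatim filing by a prover seat as
`Theorems/WeightedInvariantLocalWeightedDropNCDirectrixCutWeierstrassFactors.lean` (`--supports stmt-ResolutionOfSingularities-8899 --as helper`);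
nothing of any manuscript; folklore commutative algebra over Mathlib (uniqueness of Weierstrass division / preparation,
`Mathlib.RingTheory.PowerSeries.WeierstrassPreparation`); AI-produced, gate-checked, weaker than expert review.]

The sub-skeleton `orderp_split_v2` of the line `directrix-cut` (evidence on stmt-…-8899, sha16 7b8c8fb4de6c77c6) cuts the GOOD corner of the
wild core after the Weierstrass witness (…NCDirectrixCutWeierstrass: `Φ^* f = u · h`, `h = x₀^p + Σ_{i<p} a_i x₀^i`, the `a_i` free of `x₀`)
by `h` irreducible / reducible and, for irreducible `h`, by the Cossart–Piltant scope condition.  Two of its stubs are pure commutative algebra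
and THIS FILE (with its first half `…NCDirectrixCutWeierstrassTransport` = §§1–3, split off for the tree's 400-line rule by the filer res-L1-type-o4
on res-L1-w43-plan-1's word 2026-08-27T21:27:21Z; text otherwise VERBATIM, source e5193924e15813f2) PROVES THEM, for every `m + 1` and (where meaningful) every `o`:

1. `exists_slotZeroEquiv` / `slotZeroEquiv_spec` — the transport `k⟦x_0, …, x_m⟧ ≅ A⟦T⟧`, `A = k⟦x_1, …, x_m⟧`, `x_0 ↦ T`, packaged
   DEF-FREE as an existential with its coefficient formula; series free of `x₀` go to constants `C a`.
2. `coeff_single_zero_weierstrassPoly`, `constantCoeff_weierstrassPoly` — the `x₀^i`-coefficient of `x₀^o + Σ_{j<o} a_j x₀^j` is `a_i(0)`.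
3. `eq_zero_of_weierstrassPoly_dvd` — UNIQUENESS OF WEIERSTRASS DIVISION: if the `a_i(0)` vanish (`h` distinguished) and `h ∣ c` with `c`
   free of `x₀`, then `c = 0` (Mathlib `PowerSeries.IsWeierstrassDivisorAt.eq_zero_of_mul_eq`, transported).
4. `cpScopeTwo_of_irreducible` — STUB `T` (`stub_cpScopeOfTwoIrred`): in characteristic `2`, for `h = x₀² + a_1 x₀ + a_0` irreducible, either
   `a_1 = 0` or `G := -x₀ - a_1 = x₀ + a_1` satisfies `h ∣ G² + a_1 G + a_0` (indeed `= h`) and `h ∤ G - x₀ = a_1` (by 3., or `h` would be a unit).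
5. `exists_weierstrassFactors_of_not_irreducible` — STUB `F` (`stub_weierstrassFactorsOfReducible`): a distinguished `h` that is NOT
   irreducible is a product of two Weierstrass polynomials of positive degrees `d₁ + d₂ = o` with coefficients free of `x₀` (Weierstrass-prepare
   both factors, multiply, and compare with the trivial factorisation `h = h · 1` by Mathlib `PowerSeries.IsWeierstrassFactorization.elim`).
6. `cpScopeOfTwoIrred`, `weierstrassFactorsOfReducible` — the REGISTERED SHAPES of the two stubs, literally (`m + 1 = 4`; the order
   hypothesis `a_i(0) = 0` is derived from `ord h = ord Φ^* f = ord f = p` via `TOT2E1.order_subst_eq_of_legal` and `MvPowerSeries.order_mul`).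

After this file the `p = 2` GOOD branch of `W′|₄` rests on the two stubs `R` (`stub_reducibleOrderP`, Kollár–Mella-class descent for reducible
`h`) and `C` (`stub_cpScopeIrredOrderP`, the Cossart–Piltant engine modulo the typed leaf F-99b′); no new definitions, no new axioms. -/

set_option linter.dupNamespace false -- mandated namespace of this single-conjunct summit

namespace Summit.ResolutionOfSingularities.ResolutionOfSingularities.Theorems

namespace TameFourTupleDrop

open MvPowerSeries Literature.AlgebraicGeometry.Resolution

variable {k : Type} [Field k] {m : ℕ}

/-! ## 4. Stub `T`: the Cossart–Piltant scope condition at `p = 2` -/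

/-- **THE COSSART–PILTANT SCOPE AT `p = 2`** (stub `T` of `orderp_split_v2`, every `m`): in characteristic `2`, for
`h = x₀² + a_1 x₀ + a_0` IRREDUCIBLE with `a_0, a_1` free of `x₀`, either `a_1 = 0` (purely inseparable residual extension — inside the scope of
[CossartPiltant2019] Thm 1.4 as `h = X² + f₂`) or the scope's second alternative holds with the conjugate root `G = -x₀ - a_1 = x₀ + a_1`:
`h ∣ G² + a_1 G + a_0` (it EQUALS `h`) and `h ∤ G - x₀ = a_1` (a non-zero series free of `x₀`: if `a_1(0) ≠ 0` it is a unit and `h` is not;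
if `a_1(0) = 0` then `a_0(0) = 0` too, `h` is distinguished, and §3 applies). -/
theorem cpScopeTwo_of_irreducible [CharP k 2] (a : ℕ → MvPowerSeries (Fin (m + 1)) k)
    (ha : ∀ i (n : Fin (m + 1) →₀ ℕ), n 0 ≠ 0 → coeff n (a i) = 0) {hW : MvPowerSeries (Fin (m + 1)) k}
    (hhW : hW = X 0 ^ 2 + ∑ i ∈ Finset.range 2, a i * X 0 ^ i) (hirr : Irreducible hW) :
    (∀ i, 0 < i → i < 2 → a i = 0) ∨
      ∃ G : MvPowerSeries (Fin (m + 1)) k, (hW ∣ G ^ 2 + ∑ i ∈ Finset.range 2, a i * G ^ i) ∧ ¬ (hW ∣ G - X 0) := by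
  by_cases h1 : a 1 = 0
  · left
    intro i hi hi2
    obtain rfl : i = 1 := by omega
    exact h1
  · right
    refine ⟨-(X 0) - a 1, ⟨1, ?_⟩, ?_⟩
    · rw [mul_one, hhW, Finset.sum_range_succ, Finset.sum_range_succ, Finset.sum_range_zero,
        Finset.sum_range_succ, Finset.sum_range_succ, Finset.sum_range_zero]
      ring
    · have h2 : (2 : MvPowerSeries (Fin (m + 1)) k) = 0 := by
        have h := congrArg (algebraMap k (MvPowerSeries (Fin (m + 1)) k)) (CharP.ofNat_eq_zero k 2)
        rwa [map_ofNat, map_zero] at h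
      have hGX : -(X 0 : MvPowerSeries (Fin (m + 1)) k) - a 1 - X 0 = -(a 1) := by
        have h' : -(X 0 : MvPowerSeries (Fin (m + 1)) k) - a 1 - X 0 = -(a 1) - 2 * X 0 := by ring
        rw [h', h2, zero_mul, sub_zero]
      rw [hGX, dvd_neg]
      intro hdvd
      by_cases hc1 : constantCoeff (a 1) = 0
      · have hc0 : constantCoeff (a 0) = 0 := by
          by_contra hne
          apply hirr.not_isUnit
          rw [MvPowerSeries.isUnit_iff_constantCoeff, hhW, constantCoeff_weierstrassPoly two_pos a ha, isUnit_iff_ne_zero]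
          exact hne
        have ha0 : ∀ i < 2, constantCoeff (a i) = 0 := by
          intro i hi
          interval_cases i
          · exact hc0
          · exact hc1
        exact h1 (eq_zero_of_weierstrassPoly_dvd two_pos a (a 1) ha ha0 (ha 1) (hhW ▸ hdvd))
      · exact hirr.not_isUnit (isUnit_of_dvd_unit hdvd
          (MvPowerSeries.isUnit_iff_constantCoeff.mpr (isUnit_iff_ne_zero.mpr hc1)))

/-! ## 5. Stub `F`: the Weierstrass factors of a reducible prepared equation -/

/-- **WEIERSTRASS FACTORS OF A REDUCIBLE DISTINGUISHED SERIES** (stub `F` of `orderp_split_v2`, every `m`, every order):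
if `h = x₀^o + Σ_{i<o} a_i x₀^i` (`0 < o`, the `a_i` free of `x₀`, `a_i(0) = 0`) is NOT irreducible, then
`h = (x₀^{d₁} + Σ_{i<d₁} b_i x₀^i) · (x₀^{d₂} + Σ_{j<d₂} c_j x₀^j)` with `0 < d₁, d₂`, `d₁ + d₂ = o`, the `b_i, c_j` free of `x₀`
(Weierstrass-prepare both factors of a non-trivial factorisation over the complete local ring `k⟦x_1, …, x_m⟧`, multiply, and compare with the
trivial factorisation `h · 1` by the uniqueness `PowerSeries.IsWeierstrassFactorization.elim`). -/
theorem exists_weierstrassFactors_of_not_irreducible {o : ℕ} (ho : 0 < o) (a : ℕ → MvPowerSeries (Fin (m + 1)) k)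
    (ha : ∀ i (n : Fin (m + 1) →₀ ℕ), n 0 ≠ 0 → coeff n (a i) = 0) (ha0 : ∀ i < o, constantCoeff (a i) = 0)
    {hW : MvPowerSeries (Fin (m + 1)) k} (hhW : hW = X 0 ^ o + ∑ i ∈ Finset.range o, a i * X 0 ^ i) (hirr : ¬ Irreducible hW) :
    ∃ (d₁ d₂ : ℕ) (bc cc : ℕ → MvPowerSeries (Fin (m + 1)) k), 0 < d₁ ∧ 0 < d₂ ∧ d₁ + d₂ = o ∧
      (∀ i (n : Fin (m + 1) →₀ ℕ), n 0 ≠ 0 → coeff n (bc i) = 0) ∧ (∀ j (n : Fin (m + 1) →₀ ℕ), n 0 ≠ 0 → coeff n (cc j) = 0) ∧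
      hW = (X 0 ^ d₁ + ∑ i ∈ Finset.range d₁, bc i * X 0 ^ i) * (X 0 ^ d₂ + ∑ j ∈ Finset.range d₂, cc j * X 0 ^ j) := by
  classical
  let A := MvPowerSeries (Fin m) k
  haveI : IsAdicComplete (IsLocalRing.maximalIdeal A) A := by
    rw [Literature.AlgebraicGeometry.Resolution.maximalIdeal_mvPowerSeries_eq_span]
    infer_instance
  obtain ⟨e, hcoeff, heX⟩ := exists_slotZeroEquiv k m
  obtain ⟨hcc, hC, hCfree⟩ := slotZeroEquiv_spec hcoeff
  -- `hW` is not a unit, hence a product of two non-units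
  have hnu : ¬ IsUnit hW := by
    rw [MvPowerSeries.isUnit_iff_constantCoeff, hhW, constantCoeff_weierstrassPoly ho a ha, ha0 0 ho, isUnit_iff_ne_zero]
    exact fun h => h rfl
  have hex : ∃ g₁ g₂ : MvPowerSeries (Fin (m + 1)) k, hW = g₁ * g₂ ∧ ¬ IsUnit g₁ ∧ ¬ IsUnit g₂ := by
    by_contra hcon
    refine hirr ⟨hnu, fun g₁ g₂ hfac => ?_⟩
    by_contra hor
    exact hcon ⟨g₁, g₂, hfac, fun h => hor (Or.inl h), fun h => hor (Or.inr h)⟩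
  obtain ⟨g₁, g₂, hfac, hg₁, hg₂⟩ := hex
  -- the image `e hW` is a distinguished polynomial of degree `o`
  have hgc : ∀ n, PowerSeries.coeff n (e hW) =
      (if n = o then 1 else 0) + (if n < o then PowerSeries.constantCoeff (e (a n)) else 0) := by
    intro n
    rw [hhW]
    exact coeff_slotZeroEquiv_weierstrassPoly hcoeff heX a ha n
  have htop : PowerSeries.coeff o (e hW) = 1 := by
    rw [hgc, if_pos rfl, if_neg (lt_irrefl o), add_zero]
  have hmem : ∀ i < o, PowerSeries.coeff i (e hW) ∈ IsLocalRing.maximalIdeal A := by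
    intro i hi
    rw [IsLocalRing.mem_maximalIdeal, mem_nonunits_iff, MvPowerSeries.isUnit_iff_constantCoeff, isUnit_iff_ne_zero, not_not,
      hgc, if_neg hi.ne, if_pos hi, zero_add, ← PowerSeries.coeff_zero_eq_constantCoeff_apply, hcc, Finsupp.single_zero,
      MvPowerSeries.coeff_zero_eq_constantCoeff_apply]
    exact ha0 i hi
  have hmapne : (e hW).map (IsLocalRing.residue A) ≠ 0 := by
    intro h0
    have h1 := congrArg (PowerSeries.coeff o) h0
    rw [PowerSeries.coeff_map, htop, map_one, map_zero] at h1
    exact one_ne_zero h1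
  -- the trivial Weierstrass factorisation `e hW = P · 1`
  obtain ⟨P, hPdeg, hPmonic, hPcoe⟩ : ∃ P : Polynomial A, P.natDegree = o ∧ P.Monic ∧ (P : PowerSeries A) = e hW := by
    have hlt : (∑ i : Fin o, Polynomial.C (PowerSeries.constantCoeff (e (a i))) * Polynomial.X ^ (i : ℕ)).degree <
        (Polynomial.X ^ o : Polynomial A).degree := by
      rw [Polynomial.degree_X_pow]
      exact Polynomial.degree_sum_fin_lt _
    refine ⟨Polynomial.X ^ o + ∑ i : Fin o, Polynomial.C (PowerSeries.constantCoeff (e (a i))) * Polynomial.X ^ (i : ℕ),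
      ?_, (Polynomial.monic_X_pow o).add_of_left hlt, ?_⟩
    · rw [Polynomial.natDegree_add_eq_left_of_degree_lt hlt, Polynomial.natDegree_X_pow]
    · rw [hhW, slotZeroEquiv_weierstrassPoly hcoeff heX a ha, ← Polynomial.eval₂_C_X_eq_coe, Polynomial.eval₂_add,
        Polynomial.eval₂_X_pow, Polynomial.eval₂_finsetSum]
      congr 1
      rw [← Fin.sum_univ_eq_sum_range]
      refine Finset.sum_congr rfl fun i _ => ?_
      rw [Polynomial.eval₂_mul, Polynomial.eval₂_C, Polynomial.eval₂_X_pow]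
  have HP : (e hW).IsWeierstrassFactorization P 1 := by
    refine ⟨⟨⟨fun {n} hn => ?_⟩, hPmonic⟩, isUnit_one, by rw [mul_one, hPcoe]⟩
    rw [hPdeg] at hn
    rw [← Polynomial.coeff_coe, hPcoe]
    exact hmem n hn
  -- Weierstrass preparation of the two factors and uniqueness
  have hmap12 : (e g₁).map (IsLocalRing.residue A) * (e g₂).map (IsLocalRing.residue A) ≠ 0 := by
    rwa [← map_mul, ← map_mul, ← hfac]
  obtain ⟨f₁, h₁, H₁⟩ := PowerSeries.exists_isWeierstrassFactorization (left_ne_zero_of_mul hmap12)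
  obtain ⟨f₂, h₂, H₂⟩ := PowerSeries.exists_isWeierstrassFactorization (right_ne_zero_of_mul hmap12)
  have H12 : (e hW).IsWeierstrassFactorization (f₁ * f₂) (h₁ * h₂) := by
    have h := H₁.mul H₂
    rwa [← map_mul, ← hfac] at h
  obtain ⟨hPf, -⟩ := HP.elim H12
  -- degrees
  have hd : f₁.natDegree + f₂.natDegree = o := by
    rw [← Polynomial.Monic.natDegree_mul H₁.isDistinguishedAt.monic H₂.isDistinguishedAt.monic, ← hPf, hPdeg]
  have hpos : ∀ {g : MvPowerSeries (Fin (m + 1)) k} {f : Polynomial A} {h : PowerSeries A},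
      ¬ IsUnit g → (e g).IsWeierstrassFactorization f h → 0 < f.natDegree := by
    intro g f h hg H
    rcases Nat.eq_zero_or_pos f.natDegree with h0 | h0
    · exfalso
      apply hg
      have hf1 : f = 1 := (Polynomial.Monic.natDegree_eq_zero H.isDistinguishedAt.monic).mp h0
      have heg : e g = h := by rw [H.eq_mul, hf1, Polynomial.coe_one, one_mul]
      have hu : IsUnit (e g) := heg ▸ H.isUnit
      simpa using hu.map e.symm
    · exact h0
  -- transport back
  have hsymmX : e.symm PowerSeries.X = X 0 := by
    rw [← heX, RingEquiv.symm_apply_apply]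
  have hback : ∀ f : Polynomial A, f.Monic → e.symm (f : PowerSeries A) =
      X 0 ^ f.natDegree + ∑ j ∈ Finset.range f.natDegree, e.symm (PowerSeries.C (f.coeff j)) * X 0 ^ j := by
    intro f hf
    have hfsum : (f : PowerSeries A) =
        PowerSeries.X ^ f.natDegree + ∑ i ∈ Finset.range f.natDegree, PowerSeries.C (f.coeff i) * PowerSeries.X ^ i := by
      rw [← Polynomial.eval₂_C_X_eq_coe, Polynomial.eval₂_eq_sum_range, Finset.sum_range_succ, Polynomial.Monic.coeff_natDegree hf,
        map_one, one_mul, add_comm]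
    rw [hfsum, map_add, map_pow, map_sum, hsymmX]
    congr 1
    refine Finset.sum_congr rfl fun i _ => ?_
    rw [map_mul, map_pow, hsymmX]
  have heq : hW = (X 0 ^ f₁.natDegree + ∑ i ∈ Finset.range f₁.natDegree, e.symm (PowerSeries.C (f₁.coeff i)) * X 0 ^ i) *
      (X 0 ^ f₂.natDegree + ∑ j ∈ Finset.range f₂.natDegree, e.symm (PowerSeries.C (f₂.coeff j)) * X 0 ^ j) := by
    rw [← hback f₁ H₁.isDistinguishedAt.monic, ← hback f₂ H₂.isDistinguishedAt.monic, ← map_mul, ← Polynomial.coe_mul, ← hPf, hPcoe,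
      RingEquiv.symm_apply_apply]
  exact ⟨f₁.natDegree, f₂.natDegree, fun i => e.symm (PowerSeries.C (f₁.coeff i)), fun j => e.symm (PowerSeries.C (f₂.coeff j)),
    hpos hg₁ H₁, hpos hg₂ H₂, hd, fun i n hn => hCfree _ n hn, fun j n hn => hCfree _ n hn, heq⟩

/-! ## 6. The registered shapes (`m + 1 = 4`) -/

/-- **STUB `T` IN ITS REGISTERED SHAPE** (`orderp_split_v2.stub_cpScopeOfTwoIrred`, literally; the unused binders `[IsAlgClosed k]`, `b`, `δ`, `Φ`,
`u`, `Admissible b δ`, `δ.o = 2`, legality, boundary position, `u(0) ≠ 0`, `Φ^* f = u · h` are dropped by the `fun`). -/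
theorem cpScopeOfTwoIrred :
    ∀ (k : Type) [Field k] [CharP k 2] [IsAlgClosed k],
      ∀ (b : MvPowerSeries (Fin 4) k) (δ : Decoration k 3) (Φ : Fin 4 → MvPowerSeries (Fin 4) k) (u hW : MvPowerSeries (Fin 4) k)
        (a : ℕ → MvPowerSeries (Fin 4) k),
        Admissible b δ → δ.o = 2 →
        (∀ i, constantCoeff (Φ i) = 0) → IsUnit (Matrix.det (Matrix.of fun i j => coeff (Finsupp.single j 1) (Φ i))) →
        (∀ l ∈ δ.E, ∃ (l' : Fin 4) (v : MvPowerSeries (Fin 4) k), l' ≠ 0 ∧ constantCoeff v ≠ 0 ∧ Φ l = v * X l') →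
        constantCoeff u ≠ 0 → (∀ i (n : Fin 4 →₀ ℕ), n 0 ≠ 0 → coeff n (a i) = 0) →
        hW = X 0 ^ 2 + ∑ i ∈ Finset.range 2, a i * X 0 ^ i → subst Φ δ.f = u * hW →
        Irreducible hW →
        ((∀ i, 0 < i → i < 2 → a i = 0) ∨
          (∃ G : MvPowerSeries (Fin 4) k, (hW ∣ G ^ 2 + ∑ i ∈ Finset.range 2, a i * G ^ i) ∧ ¬ (hW ∣ G - X 0))) := by
  intro k _ _ _ b δ Φ u hW a _ _ _ _ _ _ ha hhW _ hirr
  exact cpScopeTwo_of_irreducible (m := 3) a ha hhW hirr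

/-- **STUB `F` IN ITS REGISTERED SHAPE** (`orderp_split_v2.stub_weierstrassFactorsOfReducible`, literally): the hypothesis `a_i(0) = 0` of §5 is
derived from `ord h = p` — `ord (u · h) = ord Φ^* f = ord f = δ.o = p` (`TOT2E1.order_subst_eq_of_legal`, `MvPowerSeries.order_mul`, `ord u = 0`)
and `coeff x₀^i h = a_i(0)` (§2). -/
theorem weierstrassFactorsOfReducible :
    ∀ (p : ℕ), p.Prime → ∀ (k : Type) [Field k] [CharP k p] [IsAlgClosed k],
      ∀ (b : MvPowerSeries (Fin 4) k) (δ : Decoration k 3) (Φ : Fin 4 → MvPowerSeries (Fin 4) k) (u hW : MvPowerSeries (Fin 4) k)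
        (a : ℕ → MvPowerSeries (Fin 4) k),
        Admissible b δ → δ.o = p →
        (∀ i, constantCoeff (Φ i) = 0) → IsUnit (Matrix.det (Matrix.of fun i j => coeff (Finsupp.single j 1) (Φ i))) →
        constantCoeff u ≠ 0 → (∀ i (n : Fin 4 →₀ ℕ), n 0 ≠ 0 → coeff n (a i) = 0) →
        hW = X 0 ^ p + ∑ i ∈ Finset.range p, a i * X 0 ^ i → subst Φ δ.f = u * hW →
        ¬ Irreducible hW →
        ∃ (d₁ d₂ : ℕ) (bc cc : ℕ → MvPowerSeries (Fin 4) k), 0 < d₁ ∧ 0 < d₂ ∧ d₁ + d₂ = p ∧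
          (∀ i (n : Fin 4 →₀ ℕ), n 0 ≠ 0 → coeff n (bc i) = 0) ∧ (∀ j (n : Fin 4 →₀ ℕ), n 0 ≠ 0 → coeff n (cc j) = 0) ∧
          hW = (X 0 ^ d₁ + ∑ i ∈ Finset.range d₁, bc i * X 0 ^ i) * (X 0 ^ d₂ + ∑ j ∈ Finset.range d₂, cc j * X 0 ^ j) := by
  intro p hp k _ _ _ b δ Φ u hW a hadm ho hΦ0 hdet hu ha hhW hsub hirr
  have hf : δ.f ≠ 0 := hadm.2.1.ne_zero
  have hfo : δ.f.order = (p : ℕ∞) := by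
    rw [← ho, Decoration.o, ENat.coe_toNat]
    rw [ne_eq, order_eq_top_iff]
    exact hf
  have huo : u.order = 0 := by
    have h0 : coeff (0 : Fin 4 →₀ ℕ) u ≠ 0 := by
      rwa [MvPowerSeries.coeff_zero_eq_constantCoeff_apply]
    have h := MvPowerSeries.order_le h0
    simpa using h
  have hWo : hW.order = (p : ℕ∞) := by
    have h := TOT2E1.order_subst_eq_of_legal Φ hΦ0 hdet δ.f
    rw [hsub, MvPowerSeries.order_mul, huo, zero_add, hfo] at h
    exact h
  have ha0 : ∀ i < p, constantCoeff (a i) = 0 := by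
    intro i hi
    rw [← coeff_single_zero_weierstrassPoly a ha i hi, ← hhW]
    apply MvPowerSeries.coeff_of_lt_order
    rw [hWo, Finsupp.degree_single]
    exact_mod_cast hi
  exact exists_weierstrassFactors_of_not_irreducible hp.pos a ha ha0 hhW hirr

end TameFourTupleDrop

end Summit.ResolutionOfSingularities.ResolutionOfSingularities.Theorems
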